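import Mathlib
import HarnessLib
import Summits.Langlands.Langlands.Theses.OrdinaryPrimeTransport

/-!
# Birth skeleton (BC3) for crux stmt-Langlands-17870
`Summit.Langlands.Langlands.Theses.OrdinaryPrimeTransport.RankinSelbergPoleCountR` — line `birth`

Route `route-Langlands-OrdinaryPrimeTransport` (`closes (hPA : SummandsPotentiallyAutomorphic)
(hOrd : OrdinaryPrimeExists) (hRS : RankinSelbergPoleCountR) (hT : PrimeRankTransport) (hOff : …)
(hE : …) (hU : …) : Langlands`; this crux is `hRS`, rank 4; it is the rank-guarded repair of the
refuted-misstated `RankinSelbergPoleCount`, stmt-Langlands-17212, `n = 0` witness). THE CRUX (purity-free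
Patrikis–Taylor pole count): for `n ≥ 2`, any number field `K`, `π` cuspidal on `GL_n(𝔸_K)`, a compatible
avatar `ρ₀ : Γ_K → GL_n(ℚ̄_ℓ₀)` at `ι₀` that is NOT irreducible, and STRONG potential automorphy of
every irreducible exact framed summand `σ` of `ρ₀` (`charpoly ρ₀ = charpoly σ · charpoly τ` on `Γ_K`;
conclusion: a Galois CM `F'/K` with `σ|_{F'}` irreducible and a cuspidal `Π_E` compatible with `σ|_E`
for every intermediate `E` with `F'/E` solvable) — `False`.

This file concludes the crux BY NAME from three named stubs along the route's own two-layer plan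
(`RankinSelbergPoleCountR ⇐ FramedSplitting → BrauerBookkeeping/pole count`), with the ONE step the plan
leaves implicit made EXPLICIT as the middle stub: the crux's hypothesis hands a potential-automorphy
field `F'_σ` PER SUMMAND, while every printed pole count (BLGGT Prop. 5.4.6 / Thm. 5.5.2, Patrikis–Taylor
Thm. 1.7) runs Brauer induction over ONE Galois extension over which ALL constituents are automorphic
(cross terms `L(s, σ_i ⊗ σ̄_j)`, `i ≠ j`, need both constituents automorphic over the same Brauer
subfields). So:

* `stub_constituents` (M; topological linear algebra) — FRAMED SPLITTING: a non-irreducible framed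
  `ρ₀` of rank `n ≥ 2` over `ℚ̄_ℓ₀` has a CONSTITUENT DATUM: `m ≥ 2` irreducible framed `σ_i` of ranks
  `0 < k_i < n` with `charpoly ρ₀ = ∏ charpoly σ_i` on `Γ_K` (a composition series, block-triangular
  framing, continuity of the diagonal blocks) and, for each `i`, an exact framed complement `τ_i` of rank
  `n - k_i` (block sum of the other constituents) — exactly what the crux's summand hypothesis eats.
* `stub_amalgamation` (THE REPAIR LOCUS; open as typed) — FIELD AMALGAMATION: per-summand strong potential
  automorphy of a finite family of framed representations ⇒ JOINT strong potential automorphy over ONE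
  Galois `F'/K` (all `σ_i|_{F'}` irreducible; for every `E ⊂ F'` with `F'/E` solvable a cuspidal
  `Π^i_E` compatible with `σ_i|_E`; CM-ness is not needed downstream and is dropped). Predicted by
  functoriality; with unrelated, non-solvable `Gal(F'_i/K)` a direct proof needs base change of
  `Π^i_{E ∩ F'_i}` along the possibly NON-SOLVABLE extension `E/(E ∩ F'_i)` — not available. In print
  the common field comes from ONE Moret-Bailly argument applied to the whole family (BLGGT Thm. 4.5.1 /
  Cor. 4.5.2 are stated for finite families `{r_i}`); the honest resolution is therefore a ROUTE EDIT making
  the upstream crux `SummandsPotentiallyAutomorphic` JOINT over the constituent family of `ρ₀` (and this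
  crux's hypothesis with it), after which this stub is not needed and the skeleton is stubs 1 + 3.
* `stub_jointPoleCount` (L/XL; THE HEART, durable under that repair) — the purity-free pole count proper:
  `π` cuspidal on `GL_n(𝔸_K)`, `ρ₀` compatible at `ι₀`, a constituent datum (`m ≥ 2`, `0 < k_i`,
  `charpoly ρ₀ = ∏ charpoly σ_i`) that is JOINTLY strongly potentially automorphic ⇒ `False`. Proof
  route (route header, made precise): slopes `a_i` from `|ω_{Π^i_E}| = ‖·‖^{k_i a_i}` (consistent over
  `E` via completely split places), `n a_π = Σ k_i a_i`; `D(s) = L^S(s, π × π̄)` (`π̄ =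
  CuspidalAutomorphicRepData.conj π`, Satake parameters `ᾱ`) `= L^S(s + 2a_π, π_u × π̃_u)`: simple pole at
  `p_π = 1 - 2a_π`, holomorphic non-vanishing right of it (JS); Brauer over `Gal(F'/K)`:
  `D = ∏_{i,j} D_ij`, `D_ij = ∏_E L^S(s + a_i + a_j, Π^i_{E,u} × Π̃^j_{E,u} ⊗ χ_E)^{n_E}` meromorphic
  (all factors automorphic over the COMMON field), pole order of `D_ij` at `p* = 1 - 2 a_min` equal to
  `dim Hom_K(σ_j, σ_i) ≥ 0` when `a_i = a_j = a_min` (JS pole criterion + Shahidi non-vanishing on the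
  unitary line + Chebotarev/Brauer–Nesbitt iso-detection, using `σ_i|_E` irreducible and `Π^i_E`
  cuspidal; Frobenius reciprocity sums the `E`-counts), holomorphic non-zero there otherwise; if the slopes
  are not all equal, `p* > p_π` and `∏ D_ij` has a pole at `p*` where `D` is holomorphic; if all equal,
  `ord_{p_π} ∏ D_ij ≤ -m ≤ -2` against the simple pole.
* `RankinSelbergPoleCountR_of : stubs 1–3 → RankinSelbergPoleCountR` — kernel-checked, no `sorry`: split
  `ρ₀` (stub 1), feed each constituent with its exact complement to the crux's summand hypothesis, amalgamate
  (stub 2), count poles (stub 3).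

Shape (for `ledger skeleton check` / `#h21_check_skeleton`): stubs are `theorem stub_<name> (binders) :
<goal> := by sorry`; `_Goal.stub_<name> : Prop := type_of% @stub_<name>` names each statement; the
composition takes `(h₁ : _Goal.stub_constituents) (h₂ : _Goal.stub_amalgamation)
(h₃ : _Goal.stub_jointPoleCount)` and concludes the route decl by name; the final `example` feeds the
three stubs to it. Sorries: exactly the three stubs.

Disproof used: none relevant — the crux has no `Disproof.lean` / Negative lemma (`ledger crux ls
stmt-Langlands-17870`: no workfiles before this one). Honoured instead: the negatives-index entry for THIS
line, `Theorems.OrdinaryPrimeTransportRankinSelbergPoleCount_refuted` (rank `n = 0`, `ρ₀ = 1` of rank 0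
is "not irreducible", summand clause empty): stub 1 carries the crux's guard `2 ≤ n`, and in stub 3 the
constituent datum (`m ≥ 2`, `0 < k_i`, `charpoly ρ₀ = ∏ charpoly σ_i`, degrees) forces `n = Σ k_i ≥ 2`,
so no rank-`0`/rank-`1` instance exists; the route's recorded why-might-fail (normalisation traps,
unitary vs arithmetic, self-twist poles `dim End`, GL_1 log-type data) all sit inside stub 3 and are named
in its docstring. Tree facts the stubs will want: `CuspidalAutomorphicRepData.conj` (+ Satake `ᾱ`,
ClozelAlgebraicityComplexConjProofs), `AutomorphicRepData.hasSatakeParamAt_unique_holds`,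
`ArtinLFunctionsBrauer*` (Brauer induction formalism), `ArthurClozel*` (solvable base change, for stub 2's
special cases only), Jacquet–Shalika / Shahidi facts for `GL_k × GL_k'` (to be requested as named facts).
-/

set_option linter.dupNamespace false

noncomputable section

namespace Summit.Langlands.Langlands.Cruxes.RankinSelbergPoleCountR.Birth

open Summit.Langlands.Langlands.Theses.OrdinaryPrimeTransport
open scoped BigOperators Classical NumberField
open Filter
open Literature.NumberTheory.Automorphic Literature.NumberTheory.GaloisRepresentations IsDedekindDomain
  NumberField

/-! ## 0. Named clauses (verbatim pieces of the crux) -/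

/-- STRONG POTENTIAL AUTOMORPHY of ONE framed `σ : Γ_K → GL_k(ℚ̄_ℓ₀)` at `ι₀` — VERBATIM the conclusion
of the crux's summand hypothesis (and of the upstream crux `SummandsPotentiallyAutomorphic`): a finite
Galois CM extension `F'/K` with `σ|_{F'}` irreducible such that for every intermediate `E` with `F'/E`
solvable there is a cuspidal `P` on `GL_k(𝔸_E)` Satake–Frobenius compatible with `σ|_E` at almost all
places. [cite: BarnetlambEtAl2014, Thm. 4.5.1 and §5.4] -/
@[folklore] def StrongPotAut (K : Type) [Field K] [NumberField K] (ℓ₀ : ℕ) [Fact ℓ₀.Prime]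
    (ι₀ : PadicAlgCl ℓ₀ ≃+* ℂ) (k : ℕ) (σ : FramedGaloisRep K (PadicAlgCl ℓ₀) k) : Prop :=
  ∃ (F' : Type) (_ : Field F') (_ : NumberField F') (_ : Algebra K F') (_ : IsGalois K F'),
    NumberField.IsCMField F' ∧ (σ.restrictField F').toGaloisRep.IsIrreducible ∧
      ∀ (E : Type) [Field E] [NumberField E] [Algebra K E] [Algebra E F'] [IsScalarTower K E F'],
        IsSolvable (F' ≃ₐ[E] F') →
          ∃ (hE : isCompact_glFiniteIntegralLevel k E) (P : CuspidalAutomorphicRepData k E hE),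
            ∀ᶠ w : HeightOneSpectrum (𝓞 E) in cofinite,
              Summit.Langlands.SatakeFrobCompatibleAt ι₀ P.1 (σ.restrictField E) w

/-- JOINT STRONG POTENTIAL AUTOMORPHY of a finite family `σ_i : Γ_K → GL_{k_i}(ℚ̄_ℓ₀)` (`i < m`) at
`ι₀`: ONE finite Galois extension `F'/K` (CM-ness not required) such that EVERY `σ_i|_{F'}` is
irreducible and, for every intermediate `E` with `F'/E` solvable, some cuspidal `Π^i_E` on
`GL_{k_i}(𝔸_E)` is Satake–Frobenius compatible with `σ_i|_E` almost everywhere — the shape in which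
BLGGT/Patrikis–Taylor consume potential automorphy in a pole count (one Brauer induction over
`Gal(F'/K)` for all constituents at once). [cite: PatrikisTaylor2014, Thm. 1.7 (proof) and Lemma 1.6] -/
@[folklore] def JointStrongPotAut (K : Type) [Field K] [NumberField K] (ℓ₀ : ℕ) [Fact ℓ₀.Prime]
    (ι₀ : PadicAlgCl ℓ₀ ≃+* ℂ) (m : ℕ) (k : Fin m → ℕ)
    (σ : (i : Fin m) → FramedGaloisRep K (PadicAlgCl ℓ₀) (k i)) : Prop :=
  ∃ (F' : Type) (_ : Field F') (_ : NumberField F') (_ : Algebra K F') (_ : IsGalois K F'),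
    ∀ i : Fin m, ((σ i).restrictField F').toGaloisRep.IsIrreducible ∧
      ∀ (E : Type) [Field E] [NumberField E] [Algebra K E] [Algebra E F'] [IsScalarTower K E F'],
        IsSolvable (F' ≃ₐ[E] F') →
          ∃ (hE : isCompact_glFiniteIntegralLevel (k i) E) (P : CuspidalAutomorphicRepData (k i) E hE),
            ∀ᶠ w : HeightOneSpectrum (𝓞 E) in cofinite,
              Summit.Langlands.SatakeFrobCompatibleAt ι₀ P.1 ((σ i).restrictField E) w

/-- CONSTITUENT DATUM of a framed `ρ₀ : Γ_K → GL_n(ℚ̄_ℓ₀)`: `m ≥ 2` IRREDUCIBLE framed `σ_i` of ranks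
`0 < k_i < n` with `charpoly ρ₀(g) = ∏_i charpoly σ_i(g)` for all `g ∈ Γ_K` (so `ρ₀^ss ≅ ⊕ σ_i` by
Brauer–Nesbitt) and, for each `i`, an EXACT framed complement `τ_i` of rank `n - k_i`
(`charpoly ρ₀ = charpoly σ_i · charpoly τ_i`, the crux's notion of "exact summand").
[cite: CurtisReiner1962, §82 (Brauer–Nesbitt, 30.16)] -/
@[folklore] def IsConstituentDatum (K : Type) [Field K] (ℓ₀ : ℕ) [Fact ℓ₀.Prime] (n : ℕ)
    (ρ₀ : FramedGaloisRep K (PadicAlgCl ℓ₀) n) (m : ℕ) (k : Fin m → ℕ)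
    (σ : (i : Fin m) → FramedGaloisRep K (PadicAlgCl ℓ₀) (k i)) : Prop :=
  2 ≤ m ∧ (∀ i, 0 < k i ∧ k i < n) ∧ (∀ i, (σ i).toGaloisRep.IsIrreducible) ∧
    (∀ g : Field.absoluteGaloisGroup K, ρ₀.charpoly g = ∏ i, (σ i).charpoly g) ∧
      ∀ i, ∃ τ : FramedGaloisRep K (PadicAlgCl ℓ₀) (n - k i),
        ∀ g : Field.absoluteGaloisGroup K, ρ₀.charpoly g = (σ i).charpoly g * τ.charpoly g

/-! ## 1. The stubs (the ONLY sorries of this file) -/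

/-- **STUB 1 — framed splitting into irreducible constituents** (M; provable now). A framed continuous
`ρ₀ : Γ_K → GL_n(ℚ̄_ℓ₀)`, `n ≥ 2`, which is NOT irreducible (`Representation.IsIrreducible` =
`IsSimpleOrder` of the subrepresentation lattice; for `n ≥ 1` the lattice is nontrivial, so a proper
non-zero invariant subspace exists) admits a constituent datum: refine an invariant flag to a composition
series `0 = V_0 < V_1 < ⋯ < V_m = ℚ̄_ℓ₀ⁿ` (`m ≥ 2`), conjugate `ρ₀` by a fixed `P ∈ GL_n` into block
upper-triangular form; the diagonal blocks are continuous homomorphisms `σ_i : Γ_K → GL_{k_i}` (polynomial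
in the entries), irreducible of rank `k_i = dim V_i/V_{i-1} > 0`, `det(X - ρ₀ g) = ∏ det(X - σ_i g)`
(block-triangular determinant), and `τ_i :=` the block-diagonal sum of the `σ_j`, `j ≠ i`, reindexed
along `Fin (Σ_{j≠i} k_j) ≃ Fin (n - k_i)`, is a continuous framed complement with
`charpoly ρ₀ = charpoly σ_i · charpoly τ_i`. [cite: CurtisReiner1962, §82 (30.16) and §10] -/
theorem stub_constituents (K : Type) [Field K] [NumberField K] (ℓ₀ : ℕ) [Fact ℓ₀.Prime] (n : ℕ)
    (hn : 2 ≤ n) (ρ₀ : FramedGaloisRep K (PadicAlgCl ℓ₀) n) (hρ₀ : ¬ ρ₀.toGaloisRep.IsIrreducible) :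
    ∃ (m : ℕ) (k : Fin m → ℕ) (σ : (i : Fin m) → FramedGaloisRep K (PadicAlgCl ℓ₀) (k i)),
      IsConstituentDatum K ℓ₀ n ρ₀ m k σ := by
  sorry

/-- **STUB 2 — field amalgamation** (THE REPAIR LOCUS: open as typed; predicted by functoriality). If each
member of a finite family of framed `σ_i : Γ_K → GL_{k_i}(ℚ̄_ℓ₀)` is strongly potentially automorphic
with ITS OWN Galois CM field `F'_i` (the crux's per-summand hypothesis), then the family is JOINTLY strongly
potentially automorphic over ONE Galois `F'/K`. Why it might fail / why it is hard: with `F' = F'_1⋯F'_m`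
and `E ⊂ F'` solvable-co, `σ_i` is automorphic over `E ∩ F'_i` (solvable-co in `F'_i`) but reaching `E`
is base change along `E/(E ∩ F'_i)`, inside a Galois extension with group `⊃ Gal(F'/F'_i)` — non-solvable
in general (Arthur–Clozel gives cyclic prime-degree steps only); and the compositum may destroy
irreducibility of some `σ_i|_{F'}` (take `F'` minimal only where possible). Provable special cases: all but
one `Gal(F'_i/K)` solvable; `m ≤ 1`. Intended resolution: route edit making `SummandsPotentiallyAutomorphic`
JOINT (family form of the potential automorphy theorem, one Moret-Bailly for the whole constituent family,
as BLGGT Thm. 4.5.1 / Cor. 4.5.2 are stated), after which this stub is vacuous bookkeeping.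
[cite: BarnetlambEtAl2014, Thm. 4.5.1] [cite: ArthurClozelAMS120, Ch. 3 Thm. 4.2 and Thm. 5.1] -/
theorem stub_amalgamation (K : Type) [Field K] [NumberField K] (ℓ₀ : ℕ) [Fact ℓ₀.Prime]
    (ι₀ : PadicAlgCl ℓ₀ ≃+* ℂ) (m : ℕ) (k : Fin m → ℕ)
    (σ : (i : Fin m) → FramedGaloisRep K (PadicAlgCl ℓ₀) (k i))
    (h : ∀ i, StrongPotAut K ℓ₀ ι₀ (k i) (σ i)) : JointStrongPotAut K ℓ₀ ι₀ m k σ := by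
  sorry

/-- **STUB 3 — the purity-free Rankin–Selberg pole count over a COMMON field** (L/XL; THE HEART).
`π` cuspidal on `GL_n(𝔸_K)`, `ρ₀ : Γ_K → GL_n(ℚ̄_ℓ₀)` Satake–Frobenius compatible with `(π, ι₀)` at almost
all places, `m ≥ 2` framed `σ_i` of positive ranks with `charpoly ρ₀ = ∏ charpoly σ_i` on `Γ_K`, jointly
strongly potentially automorphic over one Galois `F'/K` ⇒ `False`. Proof route: (0) slopes — `a_i ∈ ℝ` with
`|ω_{Π^i_E}| = ‖·‖_E^{k_i a_i}` for all solvable-co `E` (consistency read at places completely split in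
`F'`), `n a_π = Σ k_i a_i` from `det ρ₀ = ∏ det σ_i`; unitary twists `Π^i_{E,u}`, `π_u`; (1) Brauer
bookkeeping — with `1 = Σ_E n_E Ind_E^K χ_E` over `Gal(F'/K)` (`F'/E` elementary ⊂ solvable), the formal
Euler products `D_ij(s) := ∏_v det(1 - ι₀σ_i(Frob_v) ⊗ conj(ι₀σ_j(Frob_v)) q_v^{-s})^{-1}` satisfy
`D := L^S(s, π × π̄) = ∏_{i,j} D_ij` (compatibility + `charpoly ρ₀ = ∏ charpoly σ_i`; `π̄ =
CuspidalAutomorphicRepData.conj π`) and `D_ij = ∏_E L^S(s + a_i + a_j, Π^i_{E,u} × Π̃^j_{E,u} ⊗ χ_E)^{n_E}`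
(unitarity: Satake multiset of `Π̄_u` = inverses; Artin formalism at unramified places), hence all are
meromorphic; (2) location — `D` has a simple pole at `p_π := 1 - 2a_π` and is holomorphic non-vanishing on
`Re s ≥ p_π` otherwise (JS); `D_ij` is holomorphic non-vanishing on `Re s > 1 - a_i - a_j` (JS) and at
`s = 1 - a_i - a_j` has order `-Σ_E n_E [Π^j_{E,u} ≅ Π^i_{E,u} ⊗ χ_E]`, never a zero (Shahidi non-vanishing
on the unitary line), which for `a_i = a_j` is `-dim Hom_K(σ_j, σ_i)` (pole iff isomorphic for cuspidal
pairs; Satake a.e. ⇒ `σ_j|_E ≅ σ_i|_E ⊗ χ_E` by Chebotarev + Brauer–Nesbitt, `σ_i|_E` irreducible;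
Frobenius reciprocity `Σ_E n_E dim Hom_E(χ̄_E, W|_E) = dim W^{Γ_K}`); (3) count — `a_min ≤ a_π` with
equality iff all slopes are equal; if not all equal, at `p* := 1 - 2a_min > p_π` the right side has a pole
of order `≥ #{i : a_i = a_min} ≥ 1` (diagonal poles, cross terms within the minimal-slope family
non-negative order, all other factors holomorphic non-zero) while `D` is holomorphic — contradiction; if all
equal, `ord_{p_π} D = -1` against `ord ∏ D_ij ≤ -m ≤ -2`. Why it might fail (route's, located here):
normalisation traps (arithmetic-Frobenius L-normalisation of `SatakeFrobCompatibleAt` vs unitary JS/Shahidi;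
the slope must be read off `|ω_{Π^i_E}|`, NOT off `ι₀ det σ_i`, which is not a Hecke character of `K` a
priori); the tree's `GL_1` cuspidal data may be log-type (non-unitary) — the argument only uses their Satake
parameters and central characters; JS/Shahidi/MW facts for `GL_k × GL_{k'}` over `E` and Brauer's theorem
are to be requested as named facts. [cite: PatrikisTaylor2014, Thm. 1.7 and Lemma 1.6]
[cite: BarnetlambEtAl2014, Prop. 5.4.6 and Thm. 5.5.2] [cite: JacquetShalikaAJM1981, Thm. 5.3 and Prop. 3.6]
[cite: ShahidiAJM1981, Thm. 5.2] [cite: SerreLinearRepresentations1977, §10 Thm. 19 (Brauer)] -/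
theorem stub_jointPoleCount (n : ℕ) (K : Type) [Field K] [NumberField K]
    (hcpt : isCompact_glFiniteIntegralLevel n K) (π : CuspidalAutomorphicRepData n K hcpt)
    (ℓ₀ : ℕ) [Fact ℓ₀.Prime] (ι₀ : PadicAlgCl ℓ₀ ≃+* ℂ) (ρ₀ : FramedGaloisRep K (PadicAlgCl ℓ₀) n)
    (hρ₀ : ∀ᶠ v : HeightOneSpectrum (𝓞 K) in cofinite,
      Summit.Langlands.SatakeFrobCompatibleAt ι₀ π.1 ρ₀ v)
    (m : ℕ) (hm : 2 ≤ m) (k : Fin m → ℕ) (hk : ∀ i, 0 < k i)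
    (σ : (i : Fin m) → FramedGaloisRep K (PadicAlgCl ℓ₀) (k i))
    (hchar : ∀ g : Field.absoluteGaloisGroup K, ρ₀.charpoly g = ∏ i, (σ i).charpoly g)
    (hPA : JointStrongPotAut K ℓ₀ ι₀ m k σ) : False := by
  sorry

/-! ## 2. The stub statements as named propositions (hypotheses of the composition, by name) -/

namespace _Goal

/-- The statement of `stub_constituents` (literally its type). [folklore] -/
@[folklore] def stub_constituents : Prop :=
  type_of% @Summit.Langlands.Langlands.Cruxes.RankinSelbergPoleCountR.Birth.stub_constituents

/-- The statement of `stub_amalgamation` (literally its type). [folklore] -/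
@[folklore] def stub_amalgamation : Prop :=
  type_of% @Summit.Langlands.Langlands.Cruxes.RankinSelbergPoleCountR.Birth.stub_amalgamation

/-- The statement of `stub_jointPoleCount` (literally its type). [folklore] -/
@[folklore] def stub_jointPoleCount : Prop :=
  type_of% @Summit.Langlands.Langlands.Cruxes.RankinSelbergPoleCountR.Birth.stub_jointPoleCount

end _Goal

/-! ## 3. Composition (kernel-checked, no `sorry`): STUBS 1–3 ⟹ `RankinSelbergPoleCountR` BY NAME -/

/-- **`RankinSelbergPoleCountR` from the three stubs.** Given `n ≥ 2`, `π`, a compatible non-irreducible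
`ρ₀` and the crux's per-summand potential-automorphy hypothesis: split `ρ₀` into irreducible constituents
`σ_i` with exact complements `τ_i` (STUB 1); each `(σ_i, τ_i)` is an irreducible exact summand of rank
`0 < k_i < n`, so the hypothesis makes every `σ_i` strongly potentially automorphic; amalgamate the fields
(STUB 2); the joint pole count (STUB 3) is the contradiction. [folklore] -/
theorem RankinSelbergPoleCountR_of (h₁ : _Goal.stub_constituents) (h₂ : _Goal.stub_amalgamation)
    (h₃ : _Goal.stub_jointPoleCount) : RankinSelbergPoleCountR := by
  have H₁ : ∀ (K : Type) [Field K] [NumberField K] (ℓ₀ : ℕ) [Fact ℓ₀.Prime] (n : ℕ), 2 ≤ n →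
      ∀ (ρ₀ : FramedGaloisRep K (PadicAlgCl ℓ₀) n), ¬ ρ₀.toGaloisRep.IsIrreducible →
        ∃ (m : ℕ) (k : Fin m → ℕ) (σ : (i : Fin m) → FramedGaloisRep K (PadicAlgCl ℓ₀) (k i)),
          IsConstituentDatum K ℓ₀ n ρ₀ m k σ := h₁
  have H₂ : ∀ (K : Type) [Field K] [NumberField K] (ℓ₀ : ℕ) [Fact ℓ₀.Prime]
      (ι₀ : PadicAlgCl ℓ₀ ≃+* ℂ) (m : ℕ) (k : Fin m → ℕ)
      (σ : (i : Fin m) → FramedGaloisRep K (PadicAlgCl ℓ₀) (k i)),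
      (∀ i, StrongPotAut K ℓ₀ ι₀ (k i) (σ i)) → JointStrongPotAut K ℓ₀ ι₀ m k σ := h₂
  have H₃ : ∀ (n : ℕ) (K : Type) [Field K] [NumberField K]
      (hcpt : isCompact_glFiniteIntegralLevel n K) (π : CuspidalAutomorphicRepData n K hcpt)
      (ℓ₀ : ℕ) [Fact ℓ₀.Prime] (ι₀ : PadicAlgCl ℓ₀ ≃+* ℂ) (ρ₀ : FramedGaloisRep K (PadicAlgCl ℓ₀) n),
      (∀ᶠ v : HeightOneSpectrum (𝓞 K) in cofinite,
        Summit.Langlands.SatakeFrobCompatibleAt ι₀ π.1 ρ₀ v) →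
      ∀ (m : ℕ), 2 ≤ m → ∀ (k : Fin m → ℕ), (∀ i, 0 < k i) →
        ∀ (σ : (i : Fin m) → FramedGaloisRep K (PadicAlgCl ℓ₀) (k i)),
          (∀ g : Field.absoluteGaloisGroup K, ρ₀.charpoly g = ∏ i, (σ i).charpoly g) →
            JointStrongPotAut K ℓ₀ ι₀ m k σ → False := h₃
  intro n hn K _ _ hcpt π ℓ₀ _ ι₀ ρ₀ hρ₀ hirr hsum
  obtain ⟨m, k, σ, hD⟩ := H₁ K ℓ₀ n hn ρ₀ hirr
  obtain ⟨hm, hk, hσirr, hchar, hτ⟩ := hD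
  -- every constituent is an irreducible exact summand, hence strongly potentially automorphic
  have hPA : ∀ i, StrongPotAut K ℓ₀ ι₀ (k i) (σ i) := by
    intro i
    obtain ⟨τ, hτi⟩ := hτ i
    exact hsum (k i) (hk i).1 (hk i).2 (σ i) τ (hσirr i) hτi
  exact H₃ n K hcpt π ℓ₀ ι₀ ρ₀ hρ₀ m hm k (fun i => (hk i).1) σ hchar (H₂ K ℓ₀ ι₀ m k σ hPA)

/-- By-name sanity check (an `example`, not a declaration): the three stubs feed the composition. -/
example : RankinSelbergPoleCountR :=
  RankinSelbergPoleCountR_of stub_constituents stub_amalgamation stub_jointPoleCount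

end Summit.Langlands.Langlands.Cruxes.RankinSelbergPoleCountR.Birth

end
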